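import Literature.NumberTheory.ModularSymbols.FullLevelHomologyCuspidalClass
import Literature.NumberTheory.ModularSymbols.PeriodHomologyGroupPresentation
import HarnessLib

/-!
# The kernel of `H₁(Γ₀(N), R) → H₁(X₀(N), R)` is spanned by the classes of parabolic and elliptic elements
# (granted Knapp's presentation `ker{∞, γ∞} = Γ_ep·[Γ₀(N), Γ₀(N)]`)

Topic `Literature/NumberTheory/ModularSymbols`; namespace `Literature.NumberTheory.ModularSymbols`; sequel of
`FullLevelHomologyCuspidalClass` (`cuspidalClassMap : H₁(Γ₀(N), R) ↠ H(N; R)`) and `PeriodHomologyGroupPresentation`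
(`ellipticParabolicSubgroup = Γ_ep`, the easy half `Γ_ep·[Γ,Γ] ≤ ker`, and the NAMED FACT
`periodFunctional_ker_le_ellipticParabolic_sup_commutator` = Knapp Prop. 11.22, hard half).  Proved theorems + one definition
(`epClass`); no new named fact, no `sorry`, no instance, no notation.  Every statement depending on Knapp's presentation takes
it as the explicit hypothesis `(H : periodFunctional_ker_le_ellipticParabolic_sup_commutator)` (CONDITIONAL results).

* `epClass R γ = [γ ⊗ 1] ∈ H₁(Γ₀(N), R)`; `genClassR_eq_smul_epClass` (`[γ ⊗ r] = r·[γ ⊗ 1]`), `epClass_mul`, `epClass_one`,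
  `epClass_inv`; `epSpan N R = R·{[π ⊗ 1] : π parabolic or elliptic}`;
* `epClass_mem_epSpan_of_mem_sup` — `[γ ⊗ 1] ∈ epSpan` for every `γ ∈ Γ_ep ⊔ [Γ₀(N), Γ₀(N)]` (closure induction; no fact);
* `epClass_mem_epSpan_of_periodFunctional_eq_zero (H)` — `{∞, γ∞} = 0 ⇒ [γ ⊗ 1] ∈ epSpan` (Knapp);
* **`ker_cuspidalClassMap_le_epSpan (H)`**: `cuspidalClassMap z = 0 ⇒ z ∈ epSpan N R` — via an additive retraction
  `η : Λ → H₁(Γ₀(N), R)/epSpan`, `{∞, γ∞} ↦ [γ ⊗ 1]` (well defined exactly by Knapp's presentation), extended to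
  `ψ : H(N; R) = R ⊗ Λ → H₁/epSpan` with `ψ ∘ cuspidalClassMap = quotient map`.

Consumer: the K-line of route BSD/TeichmullerTwistDescent (crux `TwistedPeriodLatticeSaturation`): the kernel of the up/down
dictionary `H₁(Γ₀(M), ℤ_p[GL₂(ℤ/p)])^{T̃} ↠ H(p²M; ℤ_p)` is spanned by coset classes of parabolic/elliptic elements, which the
spread period map kills (`FullLevelHomologySpreadKernel`).  Nothing about any elliptic curve is asserted.

## References
* A. W. Knapp, *Elliptic Curves* (1993), Prop. 11.22, (11.34)–(11.37) (PDF pp. 242–243). [Knapp1993]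
* K. S. Brown, *Cohomology of Groups* (1982), Ch. II §3 (`H₁(G, ℤ) = G_ab`). [Brown1982]
* Ju. I. Manin, *Parabolic points and zeta functions of modular curves* (1972), §1.5, Thm. 1.9. [Manin1972]
-/

noncomputable section

namespace Literature.NumberTheory.ModularSymbols

open scoped MatrixGroups TensorProduct
open CategoryTheory CongruenceSubgroup groupHomology Finsupp
open Literature.NumberTheory.EllipticCurves.ModularForms

variable (N : ℕ) (R : Type) [CommRing R]

/-! ### The classes `[γ ⊗ 1]` and their span over parabolic / elliptic `γ` -/

/-- The class `[γ ⊗ 1] ∈ H₁(Γ₀(N), R)` of `γ ∈ Γ₀(N)`. [cite: Brown1982, Ch. II §3] -/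
def epClass (γ : Gamma0 N) : groupHomology.H1 (Rep.trivial R (Gamma0 N) R) :=
  H1π _ ((cycles₁IsoOfIsTrivial (Rep.trivial R (Gamma0 N) R)).inv (single γ 1))

/-- `[γ ⊗ r] = r · [γ ⊗ 1]`. [cite: Brown1982, Ch. II §3] -/
theorem genClassR_eq_smul_epClass (γ : Gamma0 N) (r : R) :
    H1π _ ((cycles₁IsoOfIsTrivial (Rep.trivial R (Gamma0 N) R)).inv (single γ r)) = r • epClass N R γ := by
  rw [epClass, ← map_smul, ← map_smul, smul_single, smul_eq_mul, mul_one]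

/-- `[γδ ⊗ 1] = [γ ⊗ 1] + [δ ⊗ 1]` (`H₁(Γ, R) = Γ_ab ⊗ R`). [cite: Brown1982, Ch. II §3] -/
theorem epClass_mul (γ δ : Gamma0 N) : epClass N R (γ * δ) = epClass N R γ + epClass N R δ := by
  apply (H1AddEquivOfIsTrivial (Rep.trivial R (Gamma0 N) R)).injective
  rw [map_add, epClass, epClass, epClass, H1AddEquivOfIsTrivial_single, H1AddEquivOfIsTrivial_single,
    H1AddEquivOfIsTrivial_single, map_mul, ofMul_mul, TensorProduct.add_tmul]

/-- `[1 ⊗ 1] = 0`. [cite: Brown1982, Ch. II §3] -/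
theorem epClass_one : epClass N R (1 : Gamma0 N) = 0 := by
  have h := epClass_mul N R 1 1
  rw [one_mul] at h
  exact left_eq_add.1 h

/-- `[γ⁻¹ ⊗ 1] = −[γ ⊗ 1]`. [cite: Brown1982, Ch. II §3] -/
theorem epClass_inv (γ : Gamma0 N) : epClass N R γ⁻¹ = -epClass N R γ := by
  rw [eq_neg_iff_add_eq_zero, ← epClass_mul, inv_mul_cancel, epClass_one]

/-- A commutator has class `0`: `[γδγ⁻¹δ⁻¹ ⊗ 1] = 0`. [cite: Brown1982, Ch. II §3] -/
theorem epClass_commutatorElement (γ δ : Gamma0 N) : epClass N R (γ * δ * γ⁻¹ * δ⁻¹) = 0 := by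
  rw [epClass_mul, epClass_mul, epClass_mul, epClass_inv, epClass_inv]
  abel

/-- **The span of the parabolic and elliptic classes** `R·{[π ⊗ 1] : π ∈ Γ₀(N) parabolic or elliptic} ⊆ H₁(Γ₀(N), R)`.
[cite: Knapp1993, Prop. 11.22 (PDF p. 242)] -/
def epSpan : Submodule R (groupHomology.H1 (Rep.trivial R (Gamma0 N) R)) :=
  Submodule.span R {x | ∃ π : Gamma0 N, (((π : SL(2, ℤ)) : Matrix (Fin 2) (Fin 2) ℤ).IsParabolic ∨
    ((π : SL(2, ℤ)) : Matrix (Fin 2) (Fin 2) ℤ).IsElliptic) ∧ x = epClass N R π}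

/-- A parabolic or elliptic `π` has `[π ⊗ 1] ∈ epSpan`. [cite: Knapp1993, Prop. 11.22] -/
theorem epClass_mem_epSpan {π : Gamma0 N}
    (hπ : ((π : SL(2, ℤ)) : Matrix (Fin 2) (Fin 2) ℤ).IsParabolic ∨ ((π : SL(2, ℤ)) : Matrix (Fin 2) (Fin 2) ℤ).IsElliptic) :
    epClass N R π ∈ epSpan N R :=
  Submodule.subset_span ⟨π, hπ, rfl⟩

/-- **Every `γ ∈ Γ_ep ⊔ [Γ₀(N), Γ₀(N)]` has `[γ ⊗ 1] ∈ epSpan`** (closure induction: generators are parabolic/elliptic elements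
and commutators; `[· ⊗ 1]` is additive). [cite: Knapp1993, Prop. 11.22 (PDF p. 242)] -/
theorem epClass_mem_epSpan_of_mem_sup {γ : Gamma0 N}
    (hγ : γ ∈ ellipticParabolicSubgroup N ⊔ commutator (Gamma0 N)) : epClass N R γ ∈ epSpan N R := by
  rw [ellipticParabolicSubgroup, commutator_def, Subgroup.commutator_def, ← Subgroup.closure_union] at hγ
  induction hγ using Subgroup.closure_induction with
  | mem x hx =>
    rcases hx with hx | hx
    · exact epClass_mem_epSpan N R hx
    · obtain ⟨a, -, b, -, rfl⟩ := hx
      rw [commutatorElement_def, epClass_commutatorElement]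
      exact zero_mem _
  | one => rw [epClass_one]; exact zero_mem _
  | mul x y _ _ hx hy => rw [epClass_mul]; exact add_mem hx hy
  | inv x _ hx => rw [epClass_inv]; exact neg_mem hx

variable [NeZero N]

/-- **`{∞, γ∞} = 0 ⇒ [γ ⊗ 1] ∈ epSpan`**, granted Knapp's presentation. [cite: Knapp1993, Prop. 11.22 and (11.37) (PDF pp. 242–243)] -/
theorem epClass_mem_epSpan_of_periodFunctional_eq_zero (H : periodFunctional_ker_le_ellipticParabolic_sup_commutator)
    {γ : Gamma0 N} (hγ : periodFunctional N γ = 0) : epClass N R γ ∈ epSpan N R :=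
  epClass_mem_epSpan_of_mem_sup N R (H N γ hγ)

/-- `{∞, γ∞} = {∞, δ∞}` in `Λ` ⇒ `[γ ⊗ 1] − [δ ⊗ 1] ∈ epSpan` (Knapp). [cite: Knapp1993, Prop. 11.22] -/
theorem epClass_sub_mem_epSpan_of_symbolInt_eq (H : periodFunctional_ker_le_ellipticParabolic_sup_commutator)
    {γ δ : Gamma0 N} (h : symbolInt N γ = symbolInt N δ) : epClass N R γ - epClass N R δ ∈ epSpan N R := by
  have h0' : symbolInt N (γ * δ⁻¹) = 0 := by rw [symbolInt_mul, symbolInt_inv, h, add_neg_cancel]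
  have h0 : periodFunctional N (γ * δ⁻¹) = 0 := by
    rw [← coe_symbolInt, h0', Submodule.coe_zero]
  have h2 := epClass_mem_epSpan_of_periodFunctional_eq_zero N R H h0
  rwa [epClass_mul, epClass_inv, ← sub_eq_add_neg] at h2

/-! ### The retraction `Λ → H₁(Γ₀(N), R)/epSpan` and the kernel theorem -/

/-- A set-theoretic section of `γ ↦ {∞, γ∞}` (choice). [cite: Manin1972, §1.5 Thm. 1.9] -/
def symbolSection (φ : periodHomologyHecke N) : Gamma0 N :=
  Classical.choose (symbolInt_surjective N φ)

/-- `{∞, (symbolSection φ)∞} = φ`. [cite: Manin1972, §1.5 Thm. 1.9] -/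
theorem symbolInt_symbolSection (φ : periodHomologyHecke N) : symbolInt N (symbolSection N φ) = φ :=
  Classical.choose_spec (symbolInt_surjective N φ)

/-- **The retraction** `η : Λ → H₁(Γ₀(N), R)/epSpan`, `{∞, γ∞} ↦ [γ ⊗ 1] mod epSpan` — well defined and additive exactly
by Knapp's presentation. [cite: Knapp1993, Prop. 11.22 and (11.37)] -/
def etaQuot (H : periodFunctional_ker_le_ellipticParabolic_sup_commutator) :
    periodHomologyHecke N →+ groupHomology.H1 (Rep.trivial R (Gamma0 N) R) ⧸ epSpan N R where
  toFun φ := (epSpan N R).mkQ (epClass N R (symbolSection N φ))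
  map_zero' := by
    show (epSpan N R).mkQ (epClass N R (symbolSection N 0)) = 0
    rw [Submodule.mkQ_apply, Submodule.Quotient.mk_eq_zero]
    have h := epClass_sub_mem_epSpan_of_symbolInt_eq N R H
      ((symbolInt_symbolSection N 0).trans (symbolInt_one N).symm)
    rwa [epClass_one, sub_zero] at h
  map_add' φ₁ φ₂ := by
    rw [← map_add, ← sub_eq_zero, ← map_sub, Submodule.mkQ_apply, Submodule.Quotient.mk_eq_zero, ← epClass_mul]
    exact epClass_sub_mem_epSpan_of_symbolInt_eq N R H (by
      rw [symbolInt_symbolSection, symbolInt_mul, symbolInt_symbolSection, symbolInt_symbolSection])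

/-- `η{∞, γ∞} = [γ ⊗ 1] mod epSpan`. [cite: Knapp1993, Prop. 11.22] -/
theorem etaQuot_symbolInt (H : periodFunctional_ker_le_ellipticParabolic_sup_commutator) (γ : Gamma0 N) :
    etaQuot N R H (symbolInt N γ) = (epSpan N R).mkQ (epClass N R γ) := by
  show (epSpan N R).mkQ (epClass N R (symbolSection N (symbolInt N γ))) = _
  rw [← sub_eq_zero, ← map_sub, Submodule.mkQ_apply, Submodule.Quotient.mk_eq_zero]
  exact epClass_sub_mem_epSpan_of_symbolInt_eq N R H (symbolInt_symbolSection N _)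

/-- `η` extended to `H(N; R) = R ⊗ Λ`: `r ⊗ φ ↦ r · η(φ)`. [cite: Knapp1993, Prop. 11.22] -/
def psiQuot (H : periodFunctional_ker_le_ellipticParabolic_sup_commutator) :
    CuspidalHomologyHeckeModule N R →ₗ[ℤ] groupHomology.H1 (Rep.trivial R (Gamma0 N) R) ⧸ epSpan N R :=
  TensorProduct.lift (LinearMap.mk₂ ℤ (fun (r : R) (φ : periodHomologyHecke N) => r • etaQuot N R H φ)
    (fun r₁ r₂ φ => add_smul r₁ r₂ _)
    (fun n r φ => by rw [smul_assoc])
    (fun r φ₁ φ₂ => by rw [map_add, smul_add])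
    (fun n r φ => by rw [map_zsmul, smul_comm]))

/-- `ψ(r ⊗ φ) = r · η(φ)`. [cite: Knapp1993, Prop. 11.22] -/
theorem psiQuot_tmul (H : periodFunctional_ker_le_ellipticParabolic_sup_commutator) (r : R) (φ : periodHomologyHecke N) :
    psiQuot N R H (r ⊗ₜ[ℤ] φ) = r • etaQuot N R H φ := by
  rw [psiQuot, TensorProduct.lift.tmul]
  rfl

/-- **`ψ ∘ cuspidalClassMap` is the quotient map `H₁(Γ₀(N), R) → H₁(Γ₀(N), R)/epSpan`.** [cite: Knapp1993, Prop. 11.22 and (11.37)] -/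
theorem psiQuot_cuspidalClassMap (H : periodFunctional_ker_le_ellipticParabolic_sup_commutator)
    (z : groupHomology.H1 (Rep.trivial R (Gamma0 N) R)) :
    psiQuot N R H (cuspidalClassMap N R z) = (epSpan N R).mkQ z := by
  induction z using H1_induction_on with
  | h x =>
    have hx : x = (cycles₁IsoOfIsTrivial (Rep.trivial R (Gamma0 N) R)).inv x.1 :=
      Subtype.ext (cycles₁IsoOfIsTrivial_inv_apply _).symm
    rw [hx]
    generalize x.1 = f
    induction f using Finsupp.induction_linear with
    | zero => simp
    | add f₁ f₂ h₁ h₂ => simp only [map_add, h₁, h₂]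
    | single γ r =>
      rw [cuspidalClassMap_single, ← tmul_symbolInt, psiQuot_tmul, etaQuot_symbolInt, genClassR_eq_smul_epClass, map_smul]

/-- **The kernel of `H₁(Γ₀(N), R) → H(N; R)` lies in the span of the parabolic and elliptic classes** (granted Knapp's
presentation): `cuspidalClassMap z = 0 ⇒ z ∈ R·{[π ⊗ 1] : π parabolic or elliptic}`. [cite: Knapp1993, Prop. 11.22 and (11.37) (PDF pp. 242–243)] -/
theorem ker_cuspidalClassMap_le_epSpan (H : periodFunctional_ker_le_ellipticParabolic_sup_commutator)
    {z : groupHomology.H1 (Rep.trivial R (Gamma0 N) R)} (hz : cuspidalClassMap N R z = 0) : z ∈ epSpan N R := by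
  have h := psiQuot_cuspidalClassMap N R H z
  rw [hz, map_zero, Submodule.mkQ_apply, eq_comm, Submodule.Quotient.mk_eq_zero] at h
  exact h

/-- The kernel theorem in submodule form: `ker cuspidalClassMap ≤ epSpan`. [cite: Knapp1993, Prop. 11.22] -/
theorem ker_cuspidalClassMap_le (H : periodFunctional_ker_le_ellipticParabolic_sup_commutator) :
    LinearMap.ker (cuspidalClassMap N R) ≤ epSpan N R :=
  fun _ hz => ker_cuspidalClassMap_le_epSpan N R H hz

/-- Conversely every parabolic / elliptic class dies in `H(N; R)` (no fact needed): `epSpan ≤ ker cuspidalClassMap`.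
[cite: Knapp1993, Prop. 11.1 and (11.36)] -/
theorem epSpan_le_ker : epSpan N R ≤ LinearMap.ker (cuspidalClassMap N R) := by
  rw [epSpan, Submodule.span_le]
  rintro _ ⟨π, hπ, rfl⟩
  rw [SetLike.mem_coe, LinearMap.mem_ker, epClass, cuspidalClassMap_single, one_smul, symbol_def]
  have h0 : symbolInt N π = 0 := by
    apply Subtype.ext
    rw [coe_symbolInt]
    rcases hπ with hπ | hπ
    · exact periodFunctional_eq_zero_of_isParabolic hπ
    · exact periodFunctional_eq_zero_of_isElliptic hπ
  rw [h0, TensorProduct.tmul_zero]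

end Literature.NumberTheory.ModularSymbols
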